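import Summits.RiemannHypothesis.RiemannHypothesis.Theorems.HandoffCouplingPos
import Literature.NumberTheory.LFunctions.WeilWindowSuzukiContinuityProofs
import Literature.NumberTheory.LFunctions.WeilGroundStateRealZerosProofs
import HarnessLib

/-!
# Even the NEAR-NULL coupling law (two-sided Rayleigh cut `|Re Q(u)| ≤ ε‖u‖²`) is cumulative

Cell `rh-explicit`, TRACK «HANDOFF», seat handoff-theory-1 (definitions + logic), gen2.  Companion text:
`HOME/handoff/HANDOFF-STATEMENT.md` §I.3 (i) (v1.4: «TWO-SIDED cut by Rayleigh quotient: STILL cumulative — DERIVED, not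
typed»; this file types and proves it).  Builds on `HandoffCouplingCumulative.lean` / `HandoffCouplingPos.lean` (this seat),
`HandoffSchur.lean` (prove-2) and the tree's ground-energy API (`weilGroundEnergy`, `continuousAt_weilGroundEnergy`
[Suzuki 2026 Thm 1.3 as landed], `weilGroundEnergy_nonneg_iff_holds`, `weilGroundEnergy_mul_le_re`).

HONEST FRAMING.  Nothing here is a step towards RH.  The last refuge of a Cauchy–Schwarz-type «coupling law» that might be
non-cumulative is to demand it only for old-cone functions whose Weil energy is SMALL IN ABSOLUTE VALUE (the «near-null
cluster», cut two-sidedly by the Rayleigh quotient) — far-from-null negative vectors, if any, are then unconstrained, so the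
one-line argument of `weilPositivityOn_of_handoffCoupling` does not apply.  It is cumulative ANYWAY
(`weilPositivityOn_of_handoffCouplingNearNull`): if Weil positivity failed on `C((log q)/2)`, the ground energy
`ε(t) = weilGroundEnergy t`, continuous in `t` (tree), non-negative at `t = (log 2)/2` (Yoshida) and negative at
`t = (log q)/2`, takes by the intermediate value theorem a value in `[−ε/2, 0)` at some `t′ ≤ (log q)/2`; a negative-energy
test function on that window has Rayleigh quotient in `[−ε/2, 0)` — it IS near-null — and it violates the law against a
positive-energy edge function.  Hence `H(q) → NearNull(q) → H(q⁻)` (sandwich) and `RH ↔ ∀ q prime, NearNull(q)`; the tail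
form is RH by `HandoffTailDichotomy.riemannHypothesis_iff_exists_forall_of_cumulative` (stated here directly as well).
What remains untyped (HANDOFF-STATEMENT §I.3 (i)): a SPECTRALLY cut cluster (eigenvectors of sections), which is not closed
under the constructions used here.

References: Suzuki 2026 Thm 1.3 (continuity of the ground energy) [Suzuki2026]; Yoshida 1992 Thm 1, Prop. 6
[Yoshida1992HermitianForms]; Bombieri 2000 §3–4 [Bombieri2000Weil].
-/

set_option linter.dupNamespace false  -- the mandated namespace repeats `RiemannHypothesis`

noncomputable section

open Set MeasureTheory Literature.NumberTheory.LFunctions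
open scoped Topology

namespace Summit.RiemannHypothesis.RiemannHypothesis.Theorems.HandoffDecomposition

variable {q q' : ℕ} {η ε : ℝ}

/-- **`NearNull(q)`, the near-null coupling law** (two-sided Rayleigh cut): the Cauchy–Schwarz inequality
`crossRe(u,h)² ≤ Re Q(u)·Re Q(h)` demanded only for old-cone `u ∈ C((log q)/2)` with `|Re Q(u)| ≤ ε·‖u‖₂²` and edge-layer
`h`.  Weaker than `HandoffCoupling` and than `HandoffCouplingPos` restricted to small energies; RH-implied.  A statement of
THIS track (repair census, HANDOFF-STATEMENT.md §I.3 (i)), not a literature fact. [this track (theory-1 gen2), HANDOFF-STATEMENT.md §I.3] -/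
def HandoffCouplingNearNull (q q' : ℕ) (η ε : ℝ) : Prop :=
  ∀ b ∈ Icc (Real.log q / 2) (Real.log q' / 2), ∀ u h : ℝ → ℂ, IsWeilTest u →
    tsupport u ⊆ Icc (-(Real.log q / 2)) (Real.log q / 2) →
      |(weilQuadratic u).re| ≤ ε * ∫ t : ℝ, ‖u t‖ ^ 2 →
        Handoff.IsEdgeLayer q η b h → (Handoff.crossRe u h) ^ 2 ≤ (weilQuadratic u).re * (weilQuadratic h).re

/-- `Coupling → NearNull` (restriction). [folklore] -/
theorem handoffCouplingNearNull_of_handoffCoupling (h : Handoff.HandoffCoupling q q' η) :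
    HandoffCouplingNearNull q q' η ε :=
  fun b hb u g hu hus _ hg ↦ h b hb u g hu hus hg

/-- `H(q) → NearNull(q)` for consecutive primes (any `η`, any `ε`). [this track; HandoffSchur.lean (Cauchy–Schwarz)] -/
theorem HandoffH.couplingNearNull {q : ℕ} (hq : q.Prime) (h : HandoffH q) (η ε : ℝ) :
    HandoffCouplingNearNull q (nextPrime q) η ε :=
  handoffCouplingNearNull_of_handoffCoupling
    (Handoff.handoffCoupling_of_weilPositivityOn hq.pos (lt_nextPrime q).le η
      ((handoffH_iff_weilPositivityOn hq).1 h))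

/-- **A near-null NEGATIVE test function exists below any window where positivity fails** (`0 < ε`, `2 ≤ q`,
`¬ WeilPositivityOn((log q)/2)`): some `g ∈ C((log q)/2)` has `−(ε/2)‖g‖₂² ≤ Re Q(g) < 0`.  Intermediate value theorem for
the continuous ground energy between `(log 2)/2` (where it is `≥ 0`, Yoshida) and `(log q)/2` (where it is `< 0`).
[cite: Suzuki2026, Thm. 1.3 (continuity); Yoshida1992HermitianForms Thm. 1; this track (theory-1 gen2)] -/
theorem exists_nearNull_negative_of_not_weilPositivityOn (hq : 2 ≤ q) (hε : 0 < ε)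
    (hW : ¬ WeilPositivityOn (Real.log q / 2)) :
    ∃ g : ℝ → ℂ, IsWeilTest g ∧ tsupport g ⊆ Icc (-(Real.log q / 2)) (Real.log q / 2) ∧
      (weilQuadratic g).re < 0 ∧ -(ε / 2) * ∫ t : ℝ, ‖g t‖ ^ 2 ≤ (weilQuadratic g).re := by
  set a : ℝ := Real.log q / 2 with ha_def
  set t₀ : ℝ := Real.log 2 / 2 with ht₀_def
  have ht₀ : 0 < t₀ := by have := Real.log_pos (by norm_num : (1 : ℝ) < 2); positivity
  have ht₀a : t₀ ≤ a := by
    have := Real.log_le_log (by norm_num) (show (2 : ℝ) ≤ q by exact_mod_cast hq)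
    simp only [ht₀_def, ha_def]; linarith
  have ha : 0 < a := lt_of_lt_of_le ht₀ ht₀a
  -- ε(a) < 0 and ε(t₀) ≥ 0
  have hfa : weilGroundEnergy a < 0 := by
    by_contra h
    exact hW ((weilGroundEnergy_nonneg_iff_holds ha).1 (not_lt.1 h))
  have hft₀ : 0 ≤ weilGroundEnergy t₀ :=
    (weilGroundEnergy_nonneg_iff_holds ht₀).2 (by exact_mod_cast weilPositivityOn_log_two_half_holds)
  -- IVT on [t₀, a]
  have hcont : ContinuousOn weilGroundEnergy (Icc t₀ a) :=
    continuousOn_of_forall_continuousAt fun x hx ↦ continuousAt_weilGroundEnergy (lt_of_lt_of_le ht₀ hx.1)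
  set v : ℝ := max (weilGroundEnergy a) (-(ε / 2)) with hv_def
  have hv_neg : v < 0 := max_lt hfa (by linarith)
  have hv_ge : -(ε / 2) ≤ v := le_max_right _ _
  have hv_mem : v ∈ Icc (weilGroundEnergy a) (weilGroundEnergy t₀) := ⟨le_max_left _ _, hv_neg.le.trans hft₀⟩
  obtain ⟨t', ht', hft'⟩ := intermediate_value_Icc' ht₀a hcont hv_mem
  have ht'pos : 0 < t' := lt_of_lt_of_le ht₀ ht'.1
  -- positivity fails on C(t'): a negative test function there
  have hW' : ¬ WeilPositivityOn t' := by
    intro hpos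
    have := (weilGroundEnergy_nonneg_iff_holds ht'pos).2 hpos
    rw [hft'] at this
    exact absurd this (not_le.2 hv_neg)
  unfold WeilPositivityOn at hW'
  push Not at hW'
  obtain ⟨g, hg, hgs, hneg⟩ := hW'
  refine ⟨g, hg, hgs.trans (Icc_subset_Icc (neg_le_neg ht'.2) ht'.2), hneg, ?_⟩
  -- near-null from below: ε(t')·‖g‖² ≤ Re Q(g) and ε(t') = v ≥ −ε/2
  have hlow := ConnesVanSuijlekom.weilGroundEnergy_mul_le_re hg hgs
  rw [hft'] at hlow
  have hmass : 0 ≤ ∫ t : ℝ, ‖g t‖ ^ 2 := integral_nonneg fun _ ↦ by positivity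
  nlinarith [mul_le_mul_of_nonneg_right hv_ge hmass]

/-- **The near-null coupling law is CUMULATIVE**: for `2 ≤ q < q'`, `η ≥ 0`, `ε > 0`,
`NearNull(q, q', η, ε) → WeilPositivityOn((log q)/2)`.  (A near-null negative `u` of the previous lemma, tested against a
positive-energy edge function `h₀`: `0 ≤ crossRe² ≤ Re Q(u)·Re Q(h₀) < 0`.) [this track (theory-1 gen2); Suzuki2026 Thm. 1.3] -/
theorem weilPositivityOn_of_handoffCouplingNearNull (hq : 2 ≤ q) (hqq' : q < q') (hη : 0 ≤ η) (hε : 0 < ε)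
    (hC : HandoffCouplingNearNull q q' η ε) : WeilPositivityOn (Real.log q / 2) := by
  by_contra hW
  obtain ⟨u, hu, hus, hneg, hlow⟩ := exists_nearNull_negative_of_not_weilPositivityOn hq hε hW
  obtain ⟨h, hh, hpos⟩ := exists_isEdgeLayer_re_weilQuadratic_pos (lt_of_lt_of_le (by norm_num) hq) hqq' hη
  have hq0 : (0 : ℝ) < q := by exact_mod_cast lt_of_lt_of_le (by norm_num : 0 < 2) hq
  have hle : Real.log q / 2 ≤ Real.log q' / 2 := by
    have := Real.log_le_log hq0 (show (q : ℝ) ≤ q' by exact_mod_cast hqq'.le); linarith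
  have hmass : 0 ≤ ∫ t : ℝ, ‖u t‖ ^ 2 := integral_nonneg fun _ ↦ by positivity
  have habs : |(weilQuadratic u).re| ≤ ε * ∫ t : ℝ, ‖u t‖ ^ 2 := by
    rw [abs_of_neg hneg]
    nlinarith
  have key := hC (Real.log q' / 2) ⟨hle, le_rfl⟩ u h hu hus habs hh
  nlinarith [sq_nonneg (Handoff.crossRe u h), mul_neg_of_neg_of_pos hneg hpos]

/-- **SANDWICH** for the near-null law at a prime `q` (any `η ≥ 0`, `ε > 0`): `H(q) → NearNull(q, q⁺, η, ε) → H` of every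
smaller prime (via `WeilPositivityOn((log q)/2)`). [this track (theory-1 gen2)] -/
theorem handoffCouplingNearNull_sandwich (hq : q.Prime) (hη : 0 ≤ η) (hε : 0 < ε) :
    (HandoffH q → HandoffCouplingNearNull q (nextPrime q) η ε) ∧
      (HandoffCouplingNearNull q (nextPrime q) η ε → WeilPositivityOn (Real.log q / 2)) :=
  ⟨fun h ↦ h.couplingNearNull hq η ε,
    weilPositivityOn_of_handoffCouplingNearNull hq.two_le (lt_nextPrime q) hη hε⟩

/-- **`RH ↔ ∀ q prime, NearNull(q, q⁺, η_q, ε_q)`** for any schedules `η_q ≥ 0`, `ε_q > 0` — the near-null law, as a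
family, is the Riemann hypothesis (no discount). [this track (theory-1 gen2); Bombieri2000Weil Thm. 2] -/
theorem riemannHypothesis_iff_forall_handoffCouplingNearNull {η ε : ℕ → ℝ}
    (hη : ∀ q : ℕ, q.Prime → 0 ≤ η q) (hε : ∀ q : ℕ, q.Prime → 0 < ε q) :
    Summit.RiemannHypothesis ↔ ∀ q : ℕ, q.Prime → HandoffCouplingNearNull q (nextPrime q) (η q) (ε q) := by
  rw [riemannHypothesis_iff_forall_handoffH]
  refine ⟨fun h q hq ↦ (h q hq).couplingNearNull hq _ _, fun h P hP ↦ ?_⟩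
  -- `H(P) = WeilPositivityOn((log P⁺)/2)` follows from the near-null law at the prime `P⁺`
  rw [handoffH_iff_weilPositivityOn hP]
  exact weilPositivityOn_of_handoffCouplingNearNull (nextPrime_prime P).two_le (lt_nextPrime _)
    (hη _ (nextPrime_prime P)) (hε _ (nextPrime_prime P)) (h _ (nextPrime_prime P))

/-- **The tail form is RH too**: `RH ↔ ∃ q₀, ∀ primes q ≥ q₀, NearNull(q, q⁺, η_q, ε_q)`. [this track (theory-1 gen2)] -/
theorem riemannHypothesis_iff_exists_forall_handoffCouplingNearNull {η ε : ℕ → ℝ}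
    (hη : ∀ q : ℕ, q.Prime → 0 ≤ η q) (hε : ∀ q : ℕ, q.Prime → 0 < ε q) :
    Summit.RiemannHypothesis ↔
      ∃ q₀ : ℕ, ∀ q : ℕ, q.Prime → q₀ ≤ q → HandoffCouplingNearNull q (nextPrime q) (η q) (ε q) := by
  refine ⟨fun h ↦ ⟨0, fun q hq _ ↦ (riemannHypothesis_iff_forall_handoffCouplingNearNull hη hε).1 h q hq⟩,
    fun ⟨q₀, h⟩ ↦ ?_⟩
  rw [riemannHypothesis_iff_forall_handoffH]
  intro P hP
  obtain ⟨q, hqge, hq⟩ := Nat.exists_infinite_primes (max q₀ (nextPrime P))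
  have hW := weilPositivityOn_of_handoffCouplingNearNull hq.two_le (lt_nextPrime q) (hη q hq) (hε q hq)
    (h q hq ((le_max_left _ _).trans hqge))
  rw [handoffH_iff_weilPositivityOn hP]
  refine hW.mono ?_
  have h1 : (nextPrime P : ℝ) ≤ q := by exact_mod_cast (le_max_right _ _).trans hqge
  have h0 : (0 : ℝ) < nextPrime P := by exact_mod_cast (nextPrime_prime P).pos
  linarith [Real.log_le_log h0 h1]

end Summit.RiemannHypothesis.RiemannHypothesis.Theorems.HandoffDecomposition

end
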